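import Mathlib
import Summits.NavierStokesRegularity.NavierStokesRegularity.Theorems.FilamentSkeletonRssKelvinGateRotationKernel
import Literature.Analysis.FluidPDE.AncientSimilarityVorticity
import Literature.Analysis.FluidPDE.VorticityStretching

/-!
# Route `FilamentSkeletonRss` · crux `TransverseReduction1AG` (stmt-NavierStokesRegularity-27853) · line `defect_column_gate_1AG` —
# THE VORTICITY FORM OF THE LINEARISED PROFILE OPERATOR (`curl ∘ 𝓛_(α,U⁰)` written out)

Helper file (theorems only, `--supports stmt-NavierStokesRegularity-27853 --as helper`), groundwork for the kill-first #2 stub S2a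
`WaistColumnGate1A`, whose operator `colForceVort B α gam Rc d W := curl (lerayLin α U⁰_col W)` is the CURL of the linearised
rotating-Leray profile operator at the frozen waist column (LEAD of 27853, lane ns-filament-21221-p1 g10; the brief's «first helper
targets: … the sectional reduction of colForceVort»).  HONEST FRAMING: calculus identities for the linear bookkeeping of a HYPOTHETICAL
filament-type rotating-self-similar blow-up route (MODEL rung, negative side); no stub is proved; nothing here bears on Navier–Stokes
regularity; `TransverseReduction1AG` is neither proved nor refuted.

With `ω′ = curl W`, `Ω⁰ = curl U⁰`, `𝓡V = e₃ × V − DV[e₃ × y]` (infinitesimal rotation about `e₃`):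

* `curlCLM_rotGenL_comm` — the axial-vector map is rotation equivariant: `curlCLM (J∘A − A∘J) = J (curlCLM A)`;
* `curlCLM_comp_add_comp` — polarised form of the tree's `curlCLM_comp_self`:
  `curlCLM (A∘B + B∘A) = −A(curlCLM B) − B(curlCLM A) + tr A · curlCLM B + tr B · curlCLM A`;
* `curl_rotField` — **`curl (𝓡W) = 𝓡 (curl W)`** (`W ∈ C²`);
* `curl_convect_add_convect` — **`curl (DW[U] + DU[W]) = Dω′[U] − DU[ω′] + (div U) ω′ + DΩ⁰[W] − DW[Ω⁰] + (div W) Ω⁰`** (`U, W ∈ C²`);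
* `curl_lerayLin` — **the vorticity form of the linearisation**:
  `curl (𝓛_(α,U⁰) W) = α 𝓡ω′ + ω′ + ½ Dω′[y] − Δω′ + (Dω′[U⁰] − DU⁰[ω′] + (div U⁰) ω′) + (DΩ⁰[W] − DW[Ω⁰] + (div W) Ω⁰)`
  for `W ∈ C³`, `U⁰ ∈ C²`, and `curl_lerayLin_of_isDivFree` (both fields solenoidal: the two divergence terms drop);
* `curl_lerayOp` / `curl_lerayOp_of_isDivFree` — the vorticity form of the profile operator itself (`U ∈ C³`):
  `curl (E_α U) = α 𝓡Ω + Ω + ½ DΩ[y] − ΔΩ + DΩ[U] − DU[Ω] (+ (div U) Ω)` — the steady 3D vorticity equation in rotating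
  similarity variables.
The pressure gradient is invisible to all of this (`curl ∇ = 0`, tree `curl_gradient_eq_zero_holds`), which is why S2a is stated on
`curl (lerayLin …)`.
-/

set_option linter.dupNamespace false

noncomputable section

namespace Summit.NavierStokesRegularity.NavierStokesRegularity.Theorems.DefectColumnGate

open scoped BigOperators Topology InnerProductSpace Laplacian ContDiff
open Set Function
open Literature.Analysis.FluidPDE
open Summit.NavierStokesRegularity.NavierStokesRegularity.Theorems.KelvinGate

/-! ## 1. Matrix algebra of the axial-vector map `curlCLM` -/

/-- **Rotation equivariance of the axial-vector map, infinitesimal form**: for every linear `A` on `ℝ³` and the generator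
`J = rotGenL` of the rotations about `e₃`, `curlCLM (J∘A − A∘J) = J (curlCLM A)`. -/
theorem curlCLM_rotGenL_comm (A : EuclideanSpace ℝ (Fin 3) →L[ℝ] EuclideanSpace ℝ (Fin 3)) :
    curlCLM (rotGenL.comp A - A.comp rotGenL) = rotGenL (curlCLM A) := by
  have h1 : A (rotGen (EuclideanSpace.single 0 1)) = A (EuclideanSpace.single 1 1) := by rw [rotGen_single_zero]
  have h2 : A (rotGen (EuclideanSpace.single 1 1)) = -A (EuclideanSpace.single 0 1) := by
    rw [rotGen_single_one, map_neg]
  have h3 : A (rotGen (EuclideanSpace.single 2 1)) = 0 := by rw [rotGen_single_two, map_zero]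
  ext i
  fin_cases i <;> simp [curlCLM_apply, h1, h2, h3] <;> ring

/-- **Polarised curl-of-a-product identity**: `curlCLM (A∘B + B∘A) = −A(curlCLM B) − B(curlCLM A) + tr A · curlCLM B + tr B · curlCLM A`
(from the tree's `curlCLM_comp_self` applied to `A + B`, `A`, `B`). -/
theorem curlCLM_comp_add_comp (A B : EuclideanSpace ℝ (Fin 3) →L[ℝ] EuclideanSpace ℝ (Fin 3)) :
    curlCLM (A.comp B + B.comp A) =
      -(A (curlCLM B)) - B (curlCLM A)
        + (LinearMap.trace ℝ _ (A : EuclideanSpace ℝ (Fin 3) →ₗ[ℝ] EuclideanSpace ℝ (Fin 3))) • curlCLM B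
        + (LinearMap.trace ℝ _ (B : EuclideanSpace ℝ (Fin 3) →ₗ[ℝ] EuclideanSpace ℝ (Fin 3))) • curlCLM A := by
  have e : (A + B).comp (A + B) = A.comp A + (A.comp B + B.comp A) + B.comp B := by
    rw [ContinuousLinearMap.add_comp, ContinuousLinearMap.comp_add, ContinuousLinearMap.comp_add]
    abel
  have h3 : curlCLM (A.comp B + B.comp A) =
      curlCLM ((A + B).comp (A + B)) - curlCLM (A.comp A) - curlCLM (B.comp B) := by
    rw [e]; simp only [map_add]; abel
  rw [h3, curlCLM_comp_self, curlCLM_comp_self, curlCLM_comp_self, map_add, ContinuousLinearMap.toLinearMap_add,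
    map_add]
  simp only [_root_.add_apply, map_add, smul_add, add_smul]
  abel

/-! ## 2. The curl commutes with the infinitesimal rotation -/

/-- **`curl (𝓡W) = 𝓡 (curl W)`** for `W ∈ C²(ℝ³; ℝ³)`, `𝓡V (y) = e₃ × V(y) − DV(y)[e₃ × y]`: the curl is equivariant under rotations,
so it commutes with the generator of the rotations of vector fields about `e₃` (symmetry of `D²W` + `curlCLM_rotGenL_comm`). -/
theorem curl_rotField {W : EuclideanSpace ℝ (Fin 3) → EuclideanSpace ℝ (Fin 3)} (hW : ContDiff ℝ 2 W) (y : EuclideanSpace ℝ (Fin 3)) :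
    curl (fun z => cross (EuclideanSpace.single 2 1) (W z) - fderiv ℝ W z (cross (EuclideanSpace.single 2 1) z)) y =
      cross (EuclideanSpace.single 2 1) (curl W y) - fderiv ℝ (curl W) y (cross (EuclideanSpace.single 2 1) y) := by
  simp only [cross_single_two_eq_rotGenL]
  set P := fderiv ℝ W with hP
  set Q := fderiv ℝ P with hQ
  have hPc : ContDiff ℝ 1 P := hW.fderiv_right (m := 1) (by norm_num)
  have hWd : HasFDerivAt W (P y) y := (hW.differentiable (by norm_num) y).hasFDerivAt
  have hPd : HasFDerivAt P (Q y) y := (hPc.differentiable (by norm_num) y).hasFDerivAt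
  have hJd : HasFDerivAt (fun w : EuclideanSpace ℝ (Fin 3) => rotGenL w) rotGenL y := rotGenL.hasFDerivAt
  have hRWd : HasFDerivAt (fun w => rotGenL (W w) - P w (rotGenL w))
      (rotGenL.comp (P y) - ((P y).comp rotGenL + (Q y).flip (rotGenL y))) y :=
    (rotGenL.hasFDerivAt.comp y hWd).sub (hPd.clm_apply hJd)
  have hsymm : (Q y).flip (rotGenL y) = Q y (rotGenL y) := by
    ext k i
    rw [ContinuousLinearMap.flip_apply]
    exact congrFun (congrArg _ ((hW.contDiffAt.isSymmSndFDerivAt (by simp)) k (rotGenL y))) i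
  rw [curl_eq_curlCLM, hRWd.fderiv,
    show rotGenL.comp (P y) - ((P y).comp rotGenL + (Q y).flip (rotGenL y)) =
      (rotGenL.comp (P y) - (P y).comp rotGenL) - (Q y).flip (rotGenL y) from (sub_add_eq_sub_sub _ _ _),
    map_sub, curlCLM_rotGenL_comm, hsymm, curl_eq_curlCLM, fderiv_curl hW y, ContinuousLinearMap.comp_apply]

/-! ## 3. The curl of the bilinear convective term -/

/-- **`curl (DW[U] + DU[W]) = Dω′[U] − DU[ω′] + (div U) ω′ + DΩ[W] − DW[Ω] + (div W) Ω`** (`ω′ = curl W`, `Ω = curl U`) for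
`U, W ∈ C²(ℝ³; ℝ³)`: the polarisation of the tree's `curl_convect_self` (`curl ((u·∇)u) = (u·∇)ω − (ω·∇)u + (div u) ω`). -/
theorem curl_convect_add_convect {U W : EuclideanSpace ℝ (Fin 3) → EuclideanSpace ℝ (Fin 3)} (hU : ContDiff ℝ 2 U)
    (hW : ContDiff ℝ 2 W) (y : EuclideanSpace ℝ (Fin 3)) :
    curl (fun z => fderiv ℝ W z (U z) + fderiv ℝ U z (W z)) y =
      (fderiv ℝ (curl W) y (U y) - fderiv ℝ U y (curl W y) + VectorCalculus.divergence U y • curl W y)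
        + (fderiv ℝ (curl U) y (W y) - fderiv ℝ W y (curl U y) + VectorCalculus.divergence W y • curl U y) := by
  have hWD : HasFDerivAt (fderiv ℝ W) (fderiv ℝ (fderiv ℝ W) y) y :=
    (((hW.fderiv_right (m := 1) (by norm_num)).differentiable (by norm_num)) y).hasFDerivAt
  have hUD : HasFDerivAt (fderiv ℝ U) (fderiv ℝ (fderiv ℝ U) y) y :=
    (((hU.fderiv_right (m := 1) (by norm_num)).differentiable (by norm_num)) y).hasFDerivAt
  have hWy : HasFDerivAt W (fderiv ℝ W y) y := (hW.differentiable (by norm_num) y).hasFDerivAt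
  have hUy : HasFDerivAt U (fderiv ℝ U y) y := (hU.differentiable (by norm_num) y).hasFDerivAt
  have h1 : HasFDerivAt (fun z => fderiv ℝ W z (U z))
      ((fderiv ℝ W y).comp (fderiv ℝ U y) + (fderiv ℝ (fderiv ℝ W) y).flip (U y)) y := hWD.clm_apply hUy
  have h2 : HasFDerivAt (fun z => fderiv ℝ U z (W z))
      ((fderiv ℝ U y).comp (fderiv ℝ W y) + (fderiv ℝ (fderiv ℝ U) y).flip (W y)) y := hUD.clm_apply hWy
  have hsW : (fderiv ℝ (fderiv ℝ W) y).flip (U y) = fderiv ℝ (fderiv ℝ W) y (U y) := by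
    ext k i
    rw [ContinuousLinearMap.flip_apply]
    exact congrFun (congrArg _ ((hW.contDiffAt.isSymmSndFDerivAt (by simp)) k (U y))) i
  have hsU : (fderiv ℝ (fderiv ℝ U) y).flip (W y) = fderiv ℝ (fderiv ℝ U) y (W y) := by
    ext k i
    rw [ContinuousLinearMap.flip_apply]
    exact congrFun (congrArg _ ((hU.contDiffAt.isSymmSndFDerivAt (by simp)) k (W y))) i
  have h12 : HasFDerivAt (fun z => fderiv ℝ W z (U z) + fderiv ℝ U z (W z))
      ((fderiv ℝ W y).comp (fderiv ℝ U y) + (fderiv ℝ (fderiv ℝ W) y).flip (U y) +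
        ((fderiv ℝ U y).comp (fderiv ℝ W y) + (fderiv ℝ (fderiv ℝ U) y).flip (W y))) y := h1.add h2
  rw [curl_eq_curlCLM, h12.fderiv,
    show (fderiv ℝ W y).comp (fderiv ℝ U y) + (fderiv ℝ (fderiv ℝ W) y).flip (U y) +
        ((fderiv ℝ U y).comp (fderiv ℝ W y) + (fderiv ℝ (fderiv ℝ U) y).flip (W y)) =
      ((fderiv ℝ W y).comp (fderiv ℝ U y) + (fderiv ℝ U y).comp (fderiv ℝ W y)) +
        ((fderiv ℝ (fderiv ℝ W) y).flip (U y) + (fderiv ℝ (fderiv ℝ U) y).flip (W y)) from by abel,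
    map_add, curlCLM_comp_add_comp, map_add, hsW, hsU]
  have e1 : curlCLM (fderiv ℝ (fderiv ℝ W) y (U y)) = fderiv ℝ (curl W) y (U y) := by
    rw [fderiv_curl hW y, ContinuousLinearMap.comp_apply]
  have e2 : curlCLM (fderiv ℝ (fderiv ℝ U) y (W y)) = fderiv ℝ (curl U) y (W y) := by
    rw [fderiv_curl hU y, ContinuousLinearMap.comp_apply]
  have e3 : LinearMap.trace ℝ _ (fderiv ℝ U y : EuclideanSpace ℝ (Fin 3) →ₗ[ℝ] EuclideanSpace ℝ (Fin 3)) =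
      VectorCalculus.divergence U y := rfl
  have e4 : LinearMap.trace ℝ _ (fderiv ℝ W y : EuclideanSpace ℝ (Fin 3) →ₗ[ℝ] EuclideanSpace ℝ (Fin 3)) =
      VectorCalculus.divergence W y := rfl
  rw [e1, e2, e3, e4, ← curl_eq_curlCLM, ← curl_eq_curlCLM]
  abel

/-! ## 4. The vorticity form of the linearised profile operator -/

/-- **VORTICITY FORM OF THE LINEARISATION.**  For `W ∈ C³`, `U⁰ ∈ C²` and every rate `α`, with `ω′ = curl W`, `Ω⁰ = curl U⁰`:
`curl (𝓛_(α,U⁰) W)(y) = α (e₃ × ω′ − Dω′[e₃ × y]) + ω′ + ½ Dω′[y] − Δω′ + (Dω′[U⁰] − DU⁰[ω′] + (div U⁰) ω′) + (DΩ⁰[W] − DW[Ω⁰] + (div W) Ω⁰)`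
— rotation (`curl_rotField`), Leray drift (`curl_fderiv_apply_self`: `curl(½W + ½DW[y]) = ω′ + ½Dω′[y]`), dissipation
(`curl_laplacian`), transport/stretching/tilting (`curl_convect_add_convect`). -/
theorem curl_lerayLin (α : ℝ) {U0 W : EuclideanSpace ℝ (Fin 3) → EuclideanSpace ℝ (Fin 3)} (hU : ContDiff ℝ 2 U0)
    (hW : ContDiff ℝ 3 W) (y : EuclideanSpace ℝ (Fin 3)) :
    curl (fun z => lerayLin α U0 W z) y =
      α • (cross (EuclideanSpace.single 2 1) (curl W y) - fderiv ℝ (curl W) y (cross (EuclideanSpace.single 2 1) y))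
        + curl W y + (1/2:ℝ) • fderiv ℝ (curl W) y y - (Δ (curl W)) y
        + (fderiv ℝ (curl W) y (U0 y) - fderiv ℝ U0 y (curl W y) + VectorCalculus.divergence U0 y • curl W y)
        + (fderiv ℝ (curl U0) y (W y) - fderiv ℝ W y (curl U0 y) + VectorCalculus.divergence W y • curl U0 y) := by
  have hW2 : ContDiff ℝ 2 W := hW.of_le (by norm_num)
  have hPc : ContDiff ℝ 1 (fderiv ℝ W) := hW.fderiv_right (m := 1) (by norm_num)
  have hPUc : ContDiff ℝ 1 (fderiv ℝ U0) := hU.fderiv_right (m := 1) (by norm_num)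
  have hW1 : ContDiff ℝ 1 W := hW.of_le (by norm_num)
  have hU1 : ContDiff ℝ 1 U0 := hU.of_le (by norm_num)
  have hJc : ContDiff ℝ 1 (fun y : EuclideanSpace ℝ (Fin 3) => cross (EuclideanSpace.single 2 1) y) := by
    simp only [cross_single_two_eq_rotGenL]; exact rotGenL.contDiff
  -- differentiability of the five pieces of `𝓛 W` at `y`
  have dR : DifferentiableAt ℝ
      (fun z => cross (EuclideanSpace.single 2 1) (W z) - fderiv ℝ W z (cross (EuclideanSpace.single 2 1) z)) y := by
    have h1 : ContDiff ℝ 1 (fun z => cross (EuclideanSpace.single 2 1) (W z)) := by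
      simp only [cross_single_two_eq_rotGenL]; exact rotGenL.contDiff.comp hW1
    exact (h1.sub (hPc.clm_apply hJc)).differentiable (by norm_num) y
  have dW : DifferentiableAt ℝ W y := hW1.differentiable (by norm_num) y
  have dS : DifferentiableAt ℝ (fun z => fderiv ℝ W z z) y := (hPc.clm_apply contDiff_id).differentiable (by norm_num) y
  have dC : DifferentiableAt ℝ (fun z => fderiv ℝ W z (U0 z) + fderiv ℝ U0 z (W z)) y :=
    ((hPc.clm_apply hU1).add (hPUc.clm_apply hW1)).differentiable (by norm_num) y
  have dΔ : DifferentiableAt ℝ (Δ W) y := (KelvinGate.contDiff_one_laplacian hW).differentiable (by norm_num) y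
  -- `𝓛 W` as the combination of the pieces
  have e : (fun z => lerayLin α U0 W z) = fun z =>
      α • (cross (EuclideanSpace.single 2 1) (W z) - fderiv ℝ W z (cross (EuclideanSpace.single 2 1) z))
        + (1/2:ℝ) • W z + (1/2:ℝ) • fderiv ℝ W z z - (Δ W) z + (fderiv ℝ W z (U0 z) + fderiv ℝ U0 z (W z)) := by
    funext z; simp only [lerayLin]; abel
  have hsum : HasFDerivAt (fun z =>
      α • (cross (EuclideanSpace.single 2 1) (W z) - fderiv ℝ W z (cross (EuclideanSpace.single 2 1) z))
        + (1/2:ℝ) • W z + (1/2:ℝ) • fderiv ℝ W z z - (Δ W) z + (fderiv ℝ W z (U0 z) + fderiv ℝ U0 z (W z)))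
      (α • fderiv ℝ (fun z => cross (EuclideanSpace.single 2 1) (W z) - fderiv ℝ W z (cross (EuclideanSpace.single 2 1) z)) y
        + (1/2:ℝ) • fderiv ℝ W y + (1/2:ℝ) • fderiv ℝ (fun z => fderiv ℝ W z z) y - fderiv ℝ (Δ W) y
        + fderiv ℝ (fun z => fderiv ℝ W z (U0 z) + fderiv ℝ U0 z (W z)) y) y :=
    ((((dR.hasFDerivAt.fun_const_smul α).fun_add (dW.hasFDerivAt.fun_const_smul _)).fun_add
      (dS.hasFDerivAt.fun_const_smul _)).fun_sub dΔ.hasFDerivAt).fun_add dC.hasFDerivAt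
  rw [e, curl_eq_curlCLM, hsum.fderiv]
  simp only [map_add, map_sub, map_smul]
  rw [← curl_eq_curlCLM, ← curl_eq_curlCLM, ← curl_eq_curlCLM, ← curl_eq_curlCLM, ← curl_eq_curlCLM,
    curl_rotField hW2 y, curl_fderiv_apply_self hW2 y, curl_laplacian hW y, curl_convect_add_convect hU hW2 y]
  module

/-- **Vorticity form of the linearisation, solenoidal case** (`div U⁰ = div W = 0`, the case of the line):
`curl (𝓛_(α,U⁰) W) = α 𝓡ω′ + ω′ + ½ Dω′[y] − Δω′ + Dω′[U⁰] − DU⁰[ω′] + DΩ⁰[W] − DW[Ω⁰]`. -/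
theorem curl_lerayLin_of_isDivFree (α : ℝ) {U0 W : EuclideanSpace ℝ (Fin 3) → EuclideanSpace ℝ (Fin 3)} (hU : ContDiff ℝ 2 U0)
    (hW : ContDiff ℝ 3 W) (hdivU : VectorCalculus.IsDivFree U0) (hdivW : VectorCalculus.IsDivFree W) (y : EuclideanSpace ℝ (Fin 3)) :
    curl (fun z => lerayLin α U0 W z) y =
      α • (cross (EuclideanSpace.single 2 1) (curl W y) - fderiv ℝ (curl W) y (cross (EuclideanSpace.single 2 1) y))
        + curl W y + (1/2:ℝ) • fderiv ℝ (curl W) y y - (Δ (curl W)) y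
        + (fderiv ℝ (curl W) y (U0 y) - fderiv ℝ U0 y (curl W y))
        + (fderiv ℝ (curl U0) y (W y) - fderiv ℝ W y (curl U0 y)) := by
  rw [curl_lerayLin α hU hW y, hdivU y, hdivW y, zero_smul, zero_smul, add_zero, add_zero]

/-! ## 5. The vorticity form of the profile operator itself -/

/-- **VORTICITY FORM OF THE PROFILE OPERATOR** (`U ∈ C³`, `Ω = curl U`):
`curl (E_α U)(y) = α (e₃ × Ω − DΩ[e₃ × y]) + Ω + ½ DΩ[y] − ΔΩ + (DΩ[U] − DU[Ω] + (div U) Ω)` — the steady three-dimensional vorticity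
equation in rotating similarity variables (Leray scaling `Ω + ½ y·∇Ω`, frame rotation `α𝓡Ω`, transport `U·∇Ω`, stretching `−Ω·∇U`). -/
theorem curl_lerayOp (α : ℝ) {U : EuclideanSpace ℝ (Fin 3) → EuclideanSpace ℝ (Fin 3)} (hU : ContDiff ℝ 3 U)
    (y : EuclideanSpace ℝ (Fin 3)) :
    curl (lerayOp α U) y =
      α • (cross (EuclideanSpace.single 2 1) (curl U y) - fderiv ℝ (curl U) y (cross (EuclideanSpace.single 2 1) y))
        + curl U y + (1/2:ℝ) • fderiv ℝ (curl U) y y - (Δ (curl U)) y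
        + (fderiv ℝ (curl U) y (U y) - fderiv ℝ U y (curl U y) + VectorCalculus.divergence U y • curl U y) := by
  have hU2 : ContDiff ℝ 2 U := hU.of_le (by norm_num)
  have hPc : ContDiff ℝ 1 (fderiv ℝ U) := hU.fderiv_right (m := 1) (by norm_num)
  have hU1 : ContDiff ℝ 1 U := hU.of_le (by norm_num)
  have hJc : ContDiff ℝ 1 (fun y : EuclideanSpace ℝ (Fin 3) => cross (EuclideanSpace.single 2 1) y) := by
    simp only [cross_single_two_eq_rotGenL]; exact rotGenL.contDiff
  have dR : DifferentiableAt ℝ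
      (fun z => cross (EuclideanSpace.single 2 1) (U z) - fderiv ℝ U z (cross (EuclideanSpace.single 2 1) z)) y := by
    have h1 : ContDiff ℝ 1 (fun z => cross (EuclideanSpace.single 2 1) (U z)) := by
      simp only [cross_single_two_eq_rotGenL]; exact rotGenL.contDiff.comp hU1
    exact (h1.sub (hPc.clm_apply hJc)).differentiable (by norm_num) y
  have dU : DifferentiableAt ℝ U y := hU1.differentiable (by norm_num) y
  have dS : DifferentiableAt ℝ (fun z => fderiv ℝ U z z) y := (hPc.clm_apply contDiff_id).differentiable (by norm_num) y
  have dC : DifferentiableAt ℝ (fun z => fderiv ℝ U z (U z)) y := (hPc.clm_apply hU1).differentiable (by norm_num) y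
  have dΔ : DifferentiableAt ℝ (Δ U) y := (KelvinGate.contDiff_one_laplacian hU).differentiable (by norm_num) y
  have e : lerayOp α U = fun z =>
      α • (cross (EuclideanSpace.single 2 1) (U z) - fderiv ℝ U z (cross (EuclideanSpace.single 2 1) z))
        + (1/2:ℝ) • U z + (1/2:ℝ) • fderiv ℝ U z z - (Δ U) z + fderiv ℝ U z (U z) := by
    funext z; simp only [lerayOp]
  have hsum : HasFDerivAt (fun z =>
      α • (cross (EuclideanSpace.single 2 1) (U z) - fderiv ℝ U z (cross (EuclideanSpace.single 2 1) z))
        + (1/2:ℝ) • U z + (1/2:ℝ) • fderiv ℝ U z z - (Δ U) z + fderiv ℝ U z (U z))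
      (α • fderiv ℝ (fun z => cross (EuclideanSpace.single 2 1) (U z) - fderiv ℝ U z (cross (EuclideanSpace.single 2 1) z)) y
        + (1/2:ℝ) • fderiv ℝ U y + (1/2:ℝ) • fderiv ℝ (fun z => fderiv ℝ U z z) y - fderiv ℝ (Δ U) y
        + fderiv ℝ (fun z => fderiv ℝ U z (U z)) y) y :=
    ((((dR.hasFDerivAt.fun_const_smul α).fun_add (dU.hasFDerivAt.fun_const_smul _)).fun_add
      (dS.hasFDerivAt.fun_const_smul _)).fun_sub dΔ.hasFDerivAt).fun_add dC.hasFDerivAt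
  rw [e, curl_eq_curlCLM, hsum.fderiv]
  simp only [map_add, map_sub, map_smul]
  have hconv : curl (fun z => fderiv ℝ U z (U z)) y =
      fderiv ℝ (curl U) y (U y) - fderiv ℝ U y (curl U y) + VectorCalculus.divergence U y • curl U y := by
    have h := curl_convect_self hU2 y
    simp only [convect] at h
    exact h
  rw [← curl_eq_curlCLM, ← curl_eq_curlCLM, ← curl_eq_curlCLM, ← curl_eq_curlCLM, ← curl_eq_curlCLM,
    curl_rotField hU2 y, curl_fderiv_apply_self hU2 y, curl_laplacian hU y, hconv]
  module

/-- **Vorticity form of the profile operator, solenoidal case**: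
`curl (E_α U) = α 𝓡Ω + Ω + ½ DΩ[y] − ΔΩ + DΩ[U] − DU[Ω]` for divergence-free `U ∈ C³`.  In particular a smooth exact profile
(`E_α U + ∇P = 0`) has `α 𝓡Ω + Ω + ½ DΩ[y] − ΔΩ + DΩ[U] − DU[Ω] = 0` (the pressure is invisible to the curl). -/
theorem curl_lerayOp_of_isDivFree (α : ℝ) {U : EuclideanSpace ℝ (Fin 3) → EuclideanSpace ℝ (Fin 3)} (hU : ContDiff ℝ 3 U)
    (hdiv : VectorCalculus.IsDivFree U) (y : EuclideanSpace ℝ (Fin 3)) :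
    curl (lerayOp α U) y =
      α • (cross (EuclideanSpace.single 2 1) (curl U y) - fderiv ℝ (curl U) y (cross (EuclideanSpace.single 2 1) y))
        + curl U y + (1/2:ℝ) • fderiv ℝ (curl U) y y - (Δ (curl U)) y
        + (fderiv ℝ (curl U) y (U y) - fderiv ℝ U y (curl U y)) := by
  rw [curl_lerayOp α hU y, hdiv y, zero_smul, add_zero]

end Summit.NavierStokesRegularity.NavierStokesRegularity.Theorems.DefectColumnGate

end
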